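import Summits.Ventures.PercRepro.RLSRuleTwoLinesT1Geom
import Summits.Ventures.PercRepro.RLSPlanesT1_1
import Summits.Ventures.PercRepro.RLSSmallP

/-!
# C-025 at q = 3: `R₃⁺` on the plane «two `3`-point lines through a point» at `t = 1`, case (A) (night-3, gen 4)

`t = 1` (`ρ(E ∖ G) = p − 1`, `|K| = n + 3`, the hyperplane `H = cl(E ∖ G)`), NEITHER line inside `H`: a GLOBAL
accounting over all `14` rank-`3` subsets of `G` (the per-`B′` scheme of `t = 0` fails — a triple's own share
`t1z0 < Φ`).  No coplanar triple exists, every witness is good, the demand is at most `13` (every rank-`3` subset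
other than `G`), and the EXACT shares `ρ₃(B′)/(C(b + x, 3) − #dep(B′))` (`wPlus_ge_of_twoLines_exact`) pay `13Φ`:
for `n = 4, 5, 6` by exact evaluation (the same numbers as the landed census cells `Cells.two3_t1_p8/p9/p10`;
margins `0.89 / 1.72 / 4.09`), for `n ≥ 7` through the crude pure form `8q₀ + 16q₁ + 8q₂ ≥ 13Φ`
(`SmallP.plane6_t1_n7`, `U1.Planes1.plane6_t1`) — the crude form is FALSE at `n ≤ 6` (`−2.07 / −2.43 / −1.70`), the
exact denominators are needed there (planted control in `RLSRuleTwoLinesT1-planted.lean`).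
Case (B) — a line inside `H` — is `RLSRuleTwoLinesT1B`.  Imports `RLSRuleTwoLinesT1Geom`, the landed tables
`RLSPlanesT1_1`, `RLSSmallP`.  Axioms: standard.
-/

open scoped Matroid

namespace PercRepro

namespace NightThree

open Finset ThmH PerFlat

variable {α : Type*} [DecidableEq α] {M : Matroid α} [M.Finite]

/-! ### `t = 1`, case (A): neither line in the hyperplane — the exact shares -/

open scoped Classical in
/-- **`t = 1`, neither line inside `cl(E ∖ G)`.**  Every witness is good; the `13` rank-`3` proper subsets are all the
demand can be; the exact shares pay `13Φ` — at `n = 4, 5, 6` by exact evaluation (the landed census cells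
`Cells.two3_t1_p8/p9/p10`, margins `0.89 / 1.72 / 4.09`), from `n = 7` on through the crude pure form. -/
theorem perFlat_twoLines_t1_of_not_subset {G ℓ ℓ' : Finset α} {n : ℕ} (hG : G ∈ flatsQ M 3)
    (h : TwoLines M G ℓ ℓ') (hn : 4 ≤ n) (hK : M.eRk ((gr M \ G : Finset α) : Set α) = ((n + 3 : ℕ) : ℕ∞))
    (hℓ : ¬ (ℓ : Set α) ⊆ M.closure ((gr M \ G : Finset α) : Set α))
    (hℓ' : ¬ (ℓ' : Set α) ⊆ M.closure ((gr M \ G : Finset α) : Set α)) :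
    phiK (n + 4) 3 * ((UqG M (n + 4) 3 G).card : ℚ) ≤ ∑ S ∈ Yq M (n + 4) 3, wPlus M G S := by
  obtain ⟨K, hKsub, hKind, hKcard⟩ := exists_indep_compl_card G (p := n + 3) (le_of_eq hK.symm)
  have hKG : Disjoint K G := by
    rw [Finset.disjoint_left]
    intro x hxK hxG
    have := hKsub hxK
    rw [Finset.mem_sdiff] at this
    exact this.2 hxG
  obtain ⟨hmem3, h𝔅rank, hd34, hd5, hc3, hc4⟩ := twoLines_family hG h
  obtain ⟨hℓG, hℓ'G, hℓc, hℓ'c, hℓr, hℓ'r, hne, hGc, hsimple, hind⟩ := h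
  have h' : TwoLines M G ℓ ℓ' := ⟨hℓG, hℓ'G, hℓc, hℓ'c, hℓr, hℓ'r, hne, hGc, hsimple, hind⟩
  have hGE : G ⊆ gr M := (mem_flatsQ.1 hG).1
  -- every witness is good for both lines
  have hgood : ∀ m : Finset α, m ⊆ G → ¬ (m : Set α) ⊆ M.closure ((gr M \ G : Finset α) : Set α) →
      ∀ X, GoodWitness M m K X := by
    intro m hmG hm X C hC
    have hmE : (m : Set α) ⊆ M.E := by
      rw [← coe_gr M]; exact Finset.coe_subset.2 (hmG.trans hGE)
    rw [coplanarTriples_eq_empty_of_not_subset hmE hKsub hKind hm] at hC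
    exact absurd hC (Finset.notMem_empty C)
  have hgoodℓ := hgood ℓ hℓG hℓ
  have hgoodℓ' := hgood ℓ' hℓ'G hℓ'
  have hnotboth : ∀ B ∈ G.powersetCard 4, ¬ (ℓ ⊆ B ∧ ℓ' ⊆ B) := by
    rintro B hB ⟨hl, hl'⟩
    have : ℓ ∪ ℓ' ⊆ B := Finset.union_subset hl hl'
    rw [union_eq_of_twoLines hG h'] at this
    have := Finset.card_le_card this
    rw [(Finset.mem_powersetCard.1 hB).2] at this
    omega
  -- the demand: at most `13`
  have hdem : ((UqG M (n + 4) 3 G).card : ℚ) ≤ 13 := by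
    calc ((UqG M (n + 4) 3 G).card : ℚ)
        ≤ ((((G.powersetCard 3).erase ℓ).erase ℓ' ∪ G.powersetCard 4).card : ℚ) := by
          exact_mod_cast Finset.card_le_card (UqG_subset_of_twoLines_t1 h' hK)
      _ ≤ ((((G.powersetCard 3).erase ℓ).erase ℓ').card : ℚ) + ((G.powersetCard 4).card : ℚ) := by
          exact_mod_cast Finset.card_union_le _ _
      _ = 13 := by rw [hc3, hc4]; norm_num
  -- the exact share function, in the form of the census cells
  set f : Finset α → Finset α → ℚ := fun B X =>
    if B.card = 3 then 1 / ((X.card + 3).choose 3 : ℚ)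
    else if B.card = 4 then
      (if ℓ ⊆ B ∨ ℓ' ⊆ B then 3 / (((X.card + 4).choose 3 : ℚ) - 1) else 4 / ((X.card + 4).choose 3 : ℚ))
    else 8 / (((X.card + 5).choose 3 : ℚ) - 2) with hf
  have hsup := supply_ge_of_family hG h𝔅rank hKsub hKind n f (fun B hB X hX => by
    obtain ⟨hXK, _, _⟩ := mem_witnessFamily hX
    have hXind : M.Indep (X : Set α) := hKind.subset (Finset.coe_subset.2 hXK)
    have hXG : Disjoint X G := Finset.disjoint_of_subset_left hXK hKG
    have hBG := (h𝔅rank B hB).1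
    have hw := wPlus_ge_of_twoLines_exact hG h' hBG hXind hXG hXK ⟨fun _ => hgoodℓ X, fun _ => hgoodℓ' X⟩
    refine le_trans (le_of_eq ?_) hw
    rw [hf]
    dsimp only
    rw [Finset.mem_union, Finset.mem_union, Finset.mem_singleton] at hB
    rcases hB with (hB | hB) | hBG'
    · obtain ⟨_, hBc, hl, hl', _⟩ := hmem3 B hB
      rw [if_pos hBc, hBc]
      simp only [if_neg hl, if_neg hl', Nat.choose_self, Nat.sub_zero, Nat.cast_one, sub_zero, add_comm 3 X.card]
    · obtain ⟨_, hBc⟩ := Finset.mem_powersetCard.1 hB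
      rw [if_neg (by omega), if_pos hBc, hBc, show Nat.choose 4 3 = 4 by norm_num [Nat.choose]]
      by_cases hl : ℓ ⊆ B
      · have hl' : ¬ ℓ' ⊆ B := fun hl' => hnotboth B hB ⟨hl, hl'⟩
        simp only [if_pos (Or.inl hl), if_pos hl, if_neg hl', add_comm 4 X.card]
        norm_num
      · by_cases hl' : ℓ' ⊆ B
        · simp only [if_pos (Or.inr hl'), if_neg hl, if_pos hl', add_comm 4 X.card]
          norm_num
        · have hnor : ¬ (ℓ ⊆ B ∨ ℓ' ⊆ B) := by tauto
          simp only [if_neg hnor, if_neg hl, if_neg hl', add_comm 4 X.card]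
          norm_num
    · subst hBG'
      rw [if_neg (by omega), if_neg (by omega), hGc, show Nat.choose 5 3 = 10 by norm_num [Nat.choose]]
      simp only [if_pos hℓG, if_pos hℓ'G, add_comm 5 X.card]
      norm_num
      ring)
  -- the sum over the family
  have hsum : ∑ B ∈ ((G.powersetCard 3).erase ℓ).erase ℓ' ∪ G.powersetCard 4 ∪ {G},
      ∑ X ∈ witnessFamily K n, f B X =
      8 * (∑ i ∈ range n, ((n + 3).choose (i + 1) : ℚ) * (1 / ((i + 1 + 3).choose 3 : ℚ))) +
      4 * (∑ i ∈ range n, ((n + 3).choose (i + 1) : ℚ) * (3 / (((i + 1 + 4).choose 3 : ℚ) - 1))) +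
      (∑ i ∈ range n, ((n + 3).choose (i + 1) : ℚ) * (4 / ((i + 1 + 4).choose 3 : ℚ))) +
      (∑ i ∈ range n, ((n + 3).choose (i + 1) : ℚ) * (8 / (((i + 1 + 5).choose 3 : ℚ) - 2))) := by
    rw [Finset.sum_union hd5, Finset.sum_union hd34, Finset.sum_singleton]
    -- the triples
    have h3 : ∑ B ∈ ((G.powersetCard 3).erase ℓ).erase ℓ', ∑ X ∈ witnessFamily K n, f B X =
        8 * (∑ i ∈ range n, ((n + 3).choose (i + 1) : ℚ) * (1 / ((i + 1 + 3).choose 3 : ℚ))) := by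
      have hval : ∀ B ∈ ((G.powersetCard 3).erase ℓ).erase ℓ', ∑ X ∈ witnessFamily K n, f B X =
          ∑ i ∈ range n, ((n + 3).choose (i + 1) : ℚ) * (1 / ((i + 1 + 3).choose 3 : ℚ)) := by
        intro B hB
        obtain ⟨_, hBc, _, _, _⟩ := hmem3 B hB
        have : ∀ X ∈ witnessFamily K n, f B X = (fun x => 1 / ((x + 3).choose 3 : ℚ)) X.card := by
          intro X _
          rw [hf]
          dsimp only
          rw [if_pos hBc]
        rw [Finset.sum_congr rfl this, sum_witnessFamily K n (fun x => 1 / ((x + 3).choose 3 : ℚ)), hKcard]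
      rw [Finset.sum_congr rfl hval, Finset.sum_const, hc3, nsmul_eq_mul]
      norm_num
    -- the `4`-subsets
    have h4 : ∑ B ∈ G.powersetCard 4, ∑ X ∈ witnessFamily K n, f B X =
        2 * (∑ i ∈ range n, ((n + 3).choose (i + 1) : ℚ) * (3 / (((i + 1 + 4).choose 3 : ℚ) - 1))) +
        2 * (∑ i ∈ range n, ((n + 3).choose (i + 1) : ℚ) * (3 / (((i + 1 + 4).choose 3 : ℚ) - 1))) +
        (∑ i ∈ range n, ((n + 3).choose (i + 1) : ℚ) * (4 / ((i + 1 + 4).choose 3 : ℚ))) := by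
      apply sum_powersetCard_four_twoLines hG h'
      · intro B hB hl
        have hBc := (Finset.mem_powersetCard.1 hB).2
        have : ∀ X ∈ witnessFamily K n, f B X = (fun x => 3 / (((x + 4).choose 3 : ℚ) - 1)) X.card := by
          intro X _
          rw [hf]
          dsimp only
          rw [if_neg (by omega), if_pos hBc, if_pos (Or.inl hl)]
        rw [Finset.sum_congr rfl this, sum_witnessFamily K n (fun x => 3 / (((x + 4).choose 3 : ℚ) - 1)), hKcard]
      · intro B hB hl'
        have hBc := (Finset.mem_powersetCard.1 hB).2
        have : ∀ X ∈ witnessFamily K n, f B X = (fun x => 3 / (((x + 4).choose 3 : ℚ) - 1)) X.card := by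
          intro X _
          rw [hf]
          dsimp only
          rw [if_neg (by omega), if_pos hBc, if_pos (Or.inr hl')]
        rw [Finset.sum_congr rfl this, sum_witnessFamily K n (fun x => 3 / (((x + 4).choose 3 : ℚ) - 1)), hKcard]
      · intro B hB hl hl'
        have hBc := (Finset.mem_powersetCard.1 hB).2
        have : ∀ X ∈ witnessFamily K n, f B X = (fun x => 4 / ((x + 4).choose 3 : ℚ)) X.card := by
          intro X _
          rw [hf]
          dsimp only
          rw [if_neg (by omega), if_pos hBc, if_neg (by tauto)]
        rw [Finset.sum_congr rfl this, sum_witnessFamily K n (fun x => 4 / ((x + 4).choose 3 : ℚ)), hKcard]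
    -- the plane itself
    have h5 : ∑ X ∈ witnessFamily K n, f G X =
        ∑ i ∈ range n, ((n + 3).choose (i + 1) : ℚ) * (8 / (((i + 1 + 5).choose 3 : ℚ) - 2)) := by
      have : ∀ X ∈ witnessFamily K n, f G X = (fun x => 8 / (((x + 5).choose 3 : ℚ) - 2)) X.card := by
        intro X _
        rw [hf]
        dsimp only
        rw [if_neg (by omega), if_neg (by omega)]
      rw [Finset.sum_congr rfl this, sum_witnessFamily K n (fun x => 8 / (((x + 5).choose 3 : ℚ) - 2)), hKcard]
    rw [h3, h4, h5]
    ring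
  -- the certificate
  have hphi : phiK (n + 4) 3 = ∑ i ∈ range n, ((n + 4).choose (i + 1) : ℚ) / ((i + 4).choose 3 : ℚ) := by
    unfold phiK
    rw [phiW_eq_phiK_form n]
    rfl
  have hcert : phiK (n + 4) 3 * 13 ≤
      8 * (∑ i ∈ range n, ((n + 3).choose (i + 1) : ℚ) * (1 / ((i + 1 + 3).choose 3 : ℚ))) +
      4 * (∑ i ∈ range n, ((n + 3).choose (i + 1) : ℚ) * (3 / (((i + 1 + 4).choose 3 : ℚ) - 1))) +
      (∑ i ∈ range n, ((n + 3).choose (i + 1) : ℚ) * (4 / ((i + 1 + 4).choose 3 : ℚ))) +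
      (∑ i ∈ range n, ((n + 3).choose (i + 1) : ℚ) * (8 / (((i + 1 + 5).choose 3 : ℚ) - 2))) := by
    rcases (show n = 4 ∨ n = 5 ∨ n = 6 ∨ 7 ≤ n by omega) with h4 | h5 | h6 | h7
    · subst h4
      rw [hphi]
      norm_num [Finset.sum_range_succ, Nat.choose]
    · subst h5
      rw [hphi]
      norm_num [Finset.sum_range_succ, Nat.choose]
    · subst h6
      rw [hphi]
      norm_num [Finset.sum_range_succ, Nat.choose]
    · -- the crude pure form from `n = 7` on
      have hcrude : phiK (n + 4) 3 * 13 ≤ 8 * U1.q0Sum n + 16 * U1.q1Sum n + 8 * U1.q2Sum n := by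
        rw [hphi]
        rcases (show n = 7 ∨ 8 ≤ n by omega) with h7' | h8
        · subst h7'
          exact SmallP.plane6_t1_n7
        · exact U1.Planes1.plane6_t1 n h8
      have hA3 : U1.q0Sum n = ∑ i ∈ range n, ((n + 3).choose (i + 1) : ℚ) * (1 / ((i + 1 + 3).choose 3 : ℚ)) := by
        unfold U1.q0Sum
        apply Finset.sum_congr rfl
        intro i _
        rw [show i + 1 + 3 = i + 4 by omega]
        ring
      have hA4g : 4 * U1.q1Sum n = ∑ i ∈ range n, ((n + 3).choose (i + 1) : ℚ) * (4 / ((i + 1 + 4).choose 3 : ℚ)) := by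
        unfold U1.q1Sum
        rw [Finset.mul_sum]
        apply Finset.sum_congr rfl
        intro i _
        rw [show i + 1 + 4 = i + 5 by omega]
        ring
      have hA4L : 3 * U1.q1Sum n ≤
          ∑ i ∈ range n, ((n + 3).choose (i + 1) : ℚ) * (3 / (((i + 1 + 4).choose 3 : ℚ) - 1)) := by
        unfold U1.q1Sum
        rw [Finset.mul_sum]
        apply Finset.sum_le_sum
        intro i _
        rw [show i + 1 + 4 = i + 5 by omega]
        have hD : (1 : ℚ) < ((i + 5).choose 3 : ℚ) := by
          have h10 : 10 ≤ (i + 5).choose 3 := by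
            calc 10 = Nat.choose 5 3 := by norm_num [Nat.choose]
              _ ≤ (i + 5).choose 3 := Nat.choose_le_choose 3 (by omega)
          exact_mod_cast (show 1 < (i + 5).choose 3 by omega)
        have hC : (0 : ℚ) ≤ ((n + 3).choose (i + 1) : ℚ) := by positivity
        have hfrac : 3 / ((i + 5).choose 3 : ℚ) ≤ 3 / (((i + 5).choose 3 : ℚ) - 1) :=
          div_le_div_of_nonneg_left (by norm_num) (by linarith) (by linarith)
        calc 3 * (((n + 3).choose (i + 1) : ℚ) / ((i + 5).choose 3 : ℚ))
            = ((n + 3).choose (i + 1) : ℚ) * (3 / ((i + 5).choose 3 : ℚ)) := by ring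
          _ ≤ ((n + 3).choose (i + 1) : ℚ) * (3 / (((i + 5).choose 3 : ℚ) - 1)) :=
              mul_le_mul_of_nonneg_left hfrac hC
      have hA5 : 8 * U1.q2Sum n ≤
          ∑ i ∈ range n, ((n + 3).choose (i + 1) : ℚ) * (8 / (((i + 1 + 5).choose 3 : ℚ) - 2)) := by
        unfold U1.q2Sum
        rw [Finset.mul_sum]
        apply Finset.sum_le_sum
        intro i _
        rw [show i + 1 + 5 = i + 6 by omega]
        have hD : (2 : ℚ) < ((i + 6).choose 3 : ℚ) := by
          have h20 : 20 ≤ (i + 6).choose 3 := by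
            calc 20 = Nat.choose 6 3 := by norm_num [Nat.choose]
              _ ≤ (i + 6).choose 3 := Nat.choose_le_choose 3 (by omega)
          exact_mod_cast (show 2 < (i + 6).choose 3 by omega)
        have hC : (0 : ℚ) ≤ ((n + 3).choose (i + 1) : ℚ) := by positivity
        have hfrac : 8 / ((i + 6).choose 3 : ℚ) ≤ 8 / (((i + 6).choose 3 : ℚ) - 2) :=
          div_le_div_of_nonneg_left (by norm_num) (by linarith) (by linarith)
        calc 8 * (((n + 3).choose (i + 1) : ℚ) / ((i + 6).choose 3 : ℚ))
            = ((n + 3).choose (i + 1) : ℚ) * (8 / ((i + 6).choose 3 : ℚ)) := by ring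
          _ ≤ ((n + 3).choose (i + 1) : ℚ) * (8 / (((i + 6).choose 3 : ℚ) - 2)) :=
              mul_le_mul_of_nonneg_left hfrac hC
      linarith
  calc phiK (n + 4) 3 * ((UqG M (n + 4) 3 G).card : ℚ)
      ≤ phiK (n + 4) 3 * 13 := mul_le_mul_of_nonneg_left hdem (phiK_nonneg _ _)
    _ ≤ _ := hcert
    _ = ∑ B ∈ ((G.powersetCard 3).erase ℓ).erase ℓ' ∪ G.powersetCard 4 ∪ {G},
          ∑ X ∈ witnessFamily K n, f B X := hsum.symm
    _ ≤ ∑ S ∈ Yq M (n + 4) 3, wPlus M G S := hsup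

end NightThree

end PercRepro
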